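import Literature.LinearAlgebra.TensorNetworks.TensorCrossInterpolation
import Literature.LinearAlgebra.TensorNetworks.QuanticsTensorTrain

/-!
# Tensor cross interpolation: exact recovery of a tensor of exact TT-rank

Let `F` be a tensor with `L = n+1` legs indexed by `σ` (a function `F : List σ → K` on
configurations), and let a TCI FORM `F̃ = T₀ P₁⁻¹ T₁ P₂⁻¹ ⋯ P_n⁻¹ T_n` be built from pivot lists
with `χ_ℓ` row pivots `I_ℓ` and `χ_ℓ` column pivots `J_{ℓ+1}` at every bond `ℓ`
(`Literature.LinearAlgebra.TensorNetworks.TCIPivots`, `tciForm`, `tciEval` of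
`TensorCrossInterpolation`).  The companion file proves the INTERPOLATION property: with NESTED
pivots and nonsingular pivot matrices, `F̃ = F` on the slices used to build it
[NunezFernandezEtAl2025, §4.2; DolgovSavostyanov2020, §3.2 Thm. 1].  This file proves the
complementary EXACT-RECOVERY theorem, which needs no nesting at all:

> **Theorem** [DolgovSavostyanov2020, §3.2 Thm. 2 (exact recovery of the exact-rank tensor)].
> If `rank A^{(ℓ)} = χ_ℓ` for every unfolding matrix `A^{(ℓ)}(i_{≤ℓ}, i_{>ℓ}) = F(i_1, …, i_L)`,
> `ℓ = 1, …, L-1`, and all the pivot matrices `P_ℓ = A^{(ℓ)}(I_ℓ, J_{ℓ+1})` are nonsingular, then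
> the cross formula recovers the tensor exactly: `F̃ = F` at EVERY configuration.

(The theorem goes back to Oseledets–Tyrtyshnikov (2010), who proved it "with the additional
requirement of nestedness" [DolgovSavostyanov2020, §3.2]; it is the tensor version of property
(P2) of the matrix cross interpolation: "if a tensor has rank χ (which we define as each of the
above matrices has rank χ), then all the steps above are exact for a correct choice of pivots and
the tensor train is an exact representation of the tensor" [NunezFernandezEtAl2022, §III.B.1].)
The proof is the one-line matrix fact behind (P2) applied bond by bond, from the left: if a
kernel `A(i, j) = Σ_{t < χ} u(i)_t v(j)_t` is a sum of `χ` products and its `χ × χ` pivot matrix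
`P = A(I, J)` is nonsingular, then `A(i, J) P⁻¹ A(I, j) = A(i, j)` for ALL `i, j`
[DolgovSavostyanov2020, §2.1 (1); NunezFernandezEtAl2022, App. B.1; NunezFernandezEtAl2025, §3.1
property (i)] — so `T₀ P₁⁻¹ T₁ ⋯ P_k⁻¹ T_k`, read as a row vector on `J_{k+2}`, equals
`F(σ₀ … σ_k, J_{k+2})` by induction on `k`.

Contents (legs `0, …, n`, bonds `0, …, n+1`, as in `TensorCrossInterpolation`):

* `crossInterp_mul_eq_self`, `sum_mul_inv_mul_eq_of_sum_eq` — the matrix level over a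
  commutative ring: `C P⁻¹ R = A` for `A = U V` factoring through the pivot index type, in matrix
  and in kernel (entrywise, possibly infinite index sets) form [DolgovSavostyanov2020, §2.1 (1);
  NunezFernandezEtAl2022, App. B.1];
* `TCIPivots.BondSeparable p F ℓ` — `F(x ⊕ y) = Σ_{t < χ_ℓ} u(x)_t v(y)_t` for all multi-indices
  `x` of the legs `< ℓ` and `y` of the legs `≥ ℓ`: the unfolding `A^{(ℓ)}` factors through
  `K^{χ_ℓ}` ("rank `≤ χ_ℓ`" in the form that makes sense over any commutative ring and for
  infinitely many leg values); `TCIPivots.unfolding p F ℓ` — the unfolding matrix `A^{(ℓ)}` itself,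
  rows `List.Vector σ ℓ`, columns `List.Vector σ (n+1-ℓ)` [DolgovSavostyanov2020, §3.1];
  `bondSeparable_of_sum_eq` (fewer than `χ_ℓ` terms suffice);
* `leftProd_mul_siteMat_eq_of_bondSeparable` — the induction: `T₀ P₁⁻¹ ⋯ P_k⁻¹ T_k^{σ_k}` is the
  row vector `y ↦ F(σ₀ … σ_k ⊕ col (k+1) y)`; `tciForm_apply_of_bondSeparable`,
  `tciEval_of_bondSeparable`, `tciEval_toSeq_of_bondSeparable` — EXACT RECOVERY over a commutative
  ring: bond-separable with `χ_ℓ` terms at every inner bond and nonsingular pivot matrices imply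
  `F̃(s) = F(s)` for every configuration `s` [DolgovSavostyanov2020, §3.2 Thm. 2;
  NunezFernandezEtAl2022, §III.B.1];
* `bondSeparable_tciEval`, `tciEval_toSeq_eq_iff_bondSeparable` — conversely the TCI form itself is
  bond-separable with `χ_ℓ` terms (it is a tensor train of bond dimensions `χ_ℓ`,
  `tciEval_eq_sum_bond`), so for nonsingular pivot matrices EXACT RECOVERY HOLDS IF AND ONLY IF
  `F` IS BOND-SEPARABLE WITH `χ_ℓ` TERMS AT EVERY INNER BOND [DolgovSavostyanov2020, §3.2;
  NunezFernandezEtAl2025, §4.1];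
* `bondSeparable_of_tensorTrain`, `tciEval_ofFn_of_tensorTrain` — a TENSOR TRAIN of bond
  dimensions `r_ℓ ≤ χ_ℓ` (`Literature.LinearAlgebra.TensorNetworks.TensorTrain` of
  `QuanticsTensorTrain`, its configurations `Fin (n+1) → σ` read as the lists `List.ofFn`) is
  bond-separable (`TensorTrain.eval_append_eq_sum_bond`), hence is RECOVERED EXACTLY by the TCI
  form on any pivots with nonsingular pivot matrices [NunezFernandezEtAl2022, §III.B.1;
  DolgovSavostyanov2020, §3.2 Thm. 2];
* over a field with finitely many leg values: `rank_unfolding_le_of_bondSeparable`,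
  `rank_unfolding_eq_of_bondSeparable`, `bondSeparable_of_rank_le` (via the matrix exactness
  theorem `Literature.LinearAlgebra.Matrix.crossInterp_eq_self_of_rank_eq`), and the theorem in
  the printed form `tciEval_of_rank_eq`, `tciEval_toSeq_of_rank_eq`: `rank A^{(ℓ)} = χ_ℓ` for
  `1 ≤ ℓ ≤ n` and `det P_ℓ ≠ 0` imply `F̃ = F` everywhere; `tciEval_toSeq_eq_iff_rank_eq` — and
  conversely [DolgovSavostyanov2020, §3.2 Thm. 2].

Inverses are Mathlib's `Matrix.inv` (junk value `0` for a singular matrix), as in the companion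
files; every statement assumes `IsUnit (P_ℓ).det` for `1 ≤ ℓ ≤ n`, as the theorem does.  Not
formalised: the maximum-volume error bounds for approximately low-rank tensors and anything
algorithmic (the ALS / DMRG / parallel cross algorithms) [DolgovSavostyanov2020, §§3.3–4].

References: S. Dolgov, D. Savostyanov, *Parallel cross interpolation for high-precision
calculation of high-dimensional integrals*, Comput. Phys. Commun. 246 (2020) 106869,
arXiv:1903.11554 (`DolgovSavostyanov2020`), §2.1 eq. (1), §3.1, §3.2 Thms. 1–2 (numbering of the
arXiv version); Y. Núñez Fernández, M. Jeannin, P. T. Dumitrescu, T. Kloss, J. Kaye, O. Parcollet,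
X. Waintal, *Learning Feynman diagrams with tensor trains*, Phys. Rev. X 12 (2022) 041018,
arXiv:2207.06135 (`NunezFernandezEtAl2022`), §III.A (P2), §III.B.1, App. B.1; Y. Núñez Fernández
et al., *Learning tensor networks with tensor cross interpolation: new algorithms and libraries*,
SciPost Phys. 18 (2025) 104, arXiv:2407.02454 (`NunezFernandezEtAl2025`), §3.1, §4.1.  The
exact-recovery theorem originates with I. Oseledets, E. Tyrtyshnikov, *TT-cross approximation for
multidimensional arrays*, Linear Algebra Appl. 432 (2010) 70–88 (with nested pivots).

AI-produced formalisation (H21 engines group, seat eng-quad-2, 2026-08-21); no facts, no axioms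
beyond Mathlib's, no `sorry`.
-/

open Matrix

namespace Literature.LinearAlgebra.TensorNetworks

/-! ### Matrix level: a factorisation through the pivot index type makes the cross formula exact -/

section MatrixLevel

variable {K : Type*} [CommRing K] {m n ι : Type*} [Fintype ι] [DecidableEq ι]

/-- EXACTNESS OF THE MATRIX CROSS INTERPOLATION FROM A FACTORISATION, over a commutative ring:
if `A = U V` factors through the pivot index type `ι` (so `A` has "rank `≤ χ̃ = card ι`") and the
pivot matrix `P = A[r, c]` is nonsingular, then `C P⁻¹ R = A`: the matrix is recovered from its
`χ̃` pivot columns and `χ̃` pivot rows.  (Proof: `P = U[r, :] V[:, c]`, so both square factors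
are invertible, and `C P⁻¹ R = U V[:, c] (V[:, c])⁻¹ (U[r, :])⁻¹ U[r, :] V = U V`.)
[cite: DolgovSavostyanov2020, §2.1 (1)][cite: NunezFernandezEtAl2022, App. B.1] -/
theorem crossInterp_mul_eq_self (U : Matrix m ι K) (V : Matrix ι n K) {r : ι → m} {c : ι → n}
    (hP : IsUnit ((U * V).submatrix r c).det) :
    Literature.LinearAlgebra.Matrix.crossInterp (U * V) r c = U * V := by
  have hsub : (U * V).submatrix r c = U.submatrix r id * V.submatrix id c :=
    Matrix.submatrix_mul U V r id c Function.bijective_id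
  have hC : (U * V).submatrix id c = U * V.submatrix id c := by
    rw [Matrix.submatrix_mul U V id id c Function.bijective_id, Matrix.submatrix_id_id]
  have hR : (U * V).submatrix r id = U.submatrix r id * V := by
    rw [Matrix.submatrix_mul U V r id id Function.bijective_id, Matrix.submatrix_id_id]
  rw [hsub, Matrix.det_mul] at hP
  obtain ⟨hU, hV⟩ := IsUnit.mul_iff.mp hP
  rw [Literature.LinearAlgebra.Matrix.crossInterp_def, hsub, hC, hR, Matrix.mul_inv_rev]
  calc U * V.submatrix id c * ((V.submatrix id c)⁻¹ * (U.submatrix r id)⁻¹) * (U.submatrix r id * V)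
      = U * (V.submatrix id c * (V.submatrix id c)⁻¹) * ((U.submatrix r id)⁻¹ * U.submatrix r id)
          * V := by
        simp only [Matrix.mul_assoc]
    _ = U * V := by
        rw [Matrix.mul_nonsing_inv _ hV, Matrix.nonsing_inv_mul _ hU, Matrix.mul_one, Matrix.mul_one]

/-- KERNEL FORM of `crossInterp_mul_eq_self`, the shape used bond by bond below.  Let
`A : m → n → K` be a kernel on arbitrary (possibly infinite) index sets which, on the rows
satisfying `Pm` and the columns satisfying `Pn`, is a sum of `χ̃ = card ι` products,
`A i j = Σ_t u i t · v j t`; let the pivot rows `r x` and pivot columns `c y` lie in these sets and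
the pivot matrix `P = (A (r x) (c y))_{x y}` be nonsingular.  Then for every admissible `i`, `j`,
`Σ_z (Σ_y A i (c y) · (P⁻¹)_{y z}) · A (r z) j = A i j`, i.e. `A(i, J) P⁻¹ A(I, j) = A(i, j)`.
[cite: DolgovSavostyanov2020, §2.1 (1)][cite: NunezFernandezEtAl2022, App. B.1] -/
theorem sum_mul_inv_mul_eq_of_sum_eq {Pm : m → Prop} {Pn : n → Prop} {A : m → n → K}
    {u : m → ι → K} {v : n → ι → K} (hA : ∀ i, Pm i → ∀ j, Pn j → A i j = ∑ t, u i t * v j t)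
    {r : ι → m} {c : ι → n} (hr : ∀ x, Pm (r x)) (hc : ∀ y, Pn (c y))
    (hP : IsUnit (Matrix.of fun x y => A (r x) (c y)).det) {i : m} (hi : Pm i) {j : n}
    (hj : Pn j) :
    ∑ z, (∑ y, A i (c y) * (Matrix.of fun x y => A (r x) (c y))⁻¹ y z) * A (r z) j = A i j := by
  -- restrict to the index subtypes cut out by `Pm`, `Pn`, on which `A = U V`
  let U : Matrix {i // Pm i} ι K := Matrix.of fun i t => u i.1 t
  let V : Matrix ι {j // Pn j} K := Matrix.of fun t j => v j.1 t
  have hUV : ∀ (i : {i // Pm i}) (j : {j // Pn j}), (U * V) i j = A i.1 j.1 := fun i j => by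
    simp only [U, V, Matrix.mul_apply, Matrix.of_apply]
    exact (hA i.1 i.2 j.1 j.2).symm
  have hPmat : (U * V).submatrix (fun x => (⟨r x, hr x⟩ : {i // Pm i}))
      (fun y => (⟨c y, hc y⟩ : {j // Pn j})) = Matrix.of fun x y => A (r x) (c y) := by
    ext x y
    simp only [Matrix.submatrix_apply, Matrix.of_apply, hUV]
  have h := crossInterp_mul_eq_self U V (r := fun x => (⟨r x, hr x⟩ : {i // Pm i}))
    (c := fun y => (⟨c y, hc y⟩ : {j // Pn j})) (by rw [hPmat]; exact hP)
  have hij := congr_fun (congr_fun h ⟨i, hi⟩) ⟨j, hj⟩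
  rw [Literature.LinearAlgebra.Matrix.crossInterp_def, hPmat, Matrix.mul_apply, hUV] at hij
  simpa only [Matrix.mul_apply, Matrix.submatrix_apply, id, hUV] using hij

end MatrixLevel

/-! ### Configurations (the list helpers of `TensorCrossInterpolation` are private there) -/

section Config

variable {σ : Type*}

/-- [folklore] -/
private theorem pfx_succ' (s : ℕ → σ) (k : ℕ) : pfx s (k + 1) = pfx s k ++ [s k] := rfl

/-- [folklore] -/
private theorem length_pfx' (s : ℕ → σ) : ∀ k, (pfx s k).length = k
  | 0 => rfl
  | k + 1 => by rw [pfx_succ', List.length_append, length_pfx' s k, List.length_singleton]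

/-- [folklore] -/
private theorem pfx_toSeq_length' (l : List σ) (d : σ) : pfx (toSeq l d) l.length = l := by
  suffices h : ∀ k, k ≤ l.length → pfx (toSeq l d) k = l.take k by
    rw [h l.length le_rfl, List.take_length]
  intro k
  induction k with
  | zero => intro; simp [pfx]
  | succ k ih =>
      intro hk
      rw [pfx_succ', ih (Nat.le_of_succ_le hk), List.take_succ_eq_append_getElem hk]
      simp only [toSeq, List.getD_eq_getElem l d hk]

/-- [folklore] -/
private theorem toSeq_append_of_lt' (l₁ l₂ : List σ) (d : σ) {j : ℕ} (hj : j < l₁.length) :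
    toSeq (l₁ ++ l₂) d j = toSeq l₁ d j :=
  List.getD_append l₁ l₂ d j hj

/-- [folklore] -/
private theorem toSeq_append_of_le' (l₁ l₁' l₂ : List σ) (d : σ) (h : l₁.length = l₁'.length)
    {j : ℕ} (hj : l₁.length ≤ j) : toSeq (l₁ ++ l₂) d j = toSeq (l₁' ++ l₂) d j := by
  simp only [toSeq]
  rw [List.getD_append_right _ _ _ _ hj, List.getD_append_right _ _ _ _ (h ▸ hj), h]

end Config

namespace TCIPivots

section CommRing

variable {σ : Type*} (p : TCIPivots σ) {K : Type*} [CommRing K] (F : List σ → K)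

/-! ### Separation rank across a bond -/

/-- `F` is BOND-SEPARABLE WITH `χ_ℓ` TERMS ACROSS BOND `ℓ`: there are functions `u`, `v` of the
multi-indices left and right of the bond with `F(x ⊕ y) = Σ_{t < χ_ℓ} u(x)_t · v(y)_t` for all
`x` of length `ℓ` (legs `< ℓ`) and `y` of length `n+1-ℓ` (legs `≥ ℓ`).  Equivalently the `ℓ`-th
UNFOLDING `A^{(ℓ)}(x, y) = F(x ⊕ y)` factors through `K^{χ_ℓ}`; over a field with finitely many
leg values this is `rank A^{(ℓ)} ≤ χ_ℓ` (`bondSeparable_of_rank_le`,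
`rank_unfolding_le_of_bondSeparable`), and given a nonsingular `χ_ℓ × χ_ℓ` pivot matrix it is the
hypothesis "`rank A^{(ℓ)} = r_ℓ`" of the exact-recovery theorem.  A tensor train of bond
dimension `≤ χ_ℓ` at bond `ℓ` has this property (`TensorTrain.eval_append_eq_sum_bond`).
[cite: DolgovSavostyanov2020, §3.1 and §3.2 Thm. 2][cite: NunezFernandezEtAl2022, §III.B.1] -/
def BondSeparable (ℓ : ℕ) : Prop :=
  ∃ u v : List σ → Fin (p.χ ℓ) → K, ∀ x y : List σ, x.length = ℓ → y.length = p.n + 1 - ℓ →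
    F (x ++ y) = ∑ t, u x t * v y t

/-- The `ℓ`-th UNFOLDING MATRIX `A^{(ℓ)}` of the `(n+1)`-leg tensor `F`: rows are the
multi-indices `x = (σ₀, …, σ_{ℓ-1})` of the legs `< ℓ` (lists of length `ℓ`), columns the
multi-indices `y = (σ_ℓ, …, σ_n)` of the legs `≥ ℓ` (lists of length `n+1-ℓ`), and
`A^{(ℓ)}(x, y) = F(x ⊕ y)`.  [cite: DolgovSavostyanov2020, §3.1] -/
def unfolding (ℓ : ℕ) : Matrix (List.Vector σ ℓ) (List.Vector σ (p.n + 1 - ℓ)) K :=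
  Matrix.of fun x y => F (x.1 ++ y.1)

omit [CommRing K] in
/-- Entries of the unfolding matrix: `A^{(ℓ)}(x, y) = F(x ⊕ y)`.
[cite: DolgovSavostyanov2020, §3.1] -/
@[simp] theorem unfolding_apply (ℓ : ℕ) (x : List.Vector σ ℓ) (y : List.Vector σ (p.n + 1 - ℓ)) :
    p.unfolding F ℓ x y = F (x.1 ++ y.1) := rfl

omit [CommRing K] in
/-- The pivot matrix `P_ℓ = F(I_ℓ, J_{ℓ+1})` is the `I_ℓ × J_{ℓ+1}` submatrix
`A^{(ℓ)}(I_ℓ, J_{ℓ+1})` of the unfolding.  [cite: DolgovSavostyanov2020, §3.1] -/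
theorem submatrix_unfolding (ℓ : ℕ) :
    (p.unfolding F ℓ).submatrix (fun x => (⟨p.row ℓ x, p.length_row ℓ x⟩ : List.Vector σ ℓ))
      (fun y => (⟨p.col ℓ y, p.length_col ℓ y⟩ : List.Vector σ (p.n + 1 - ℓ))) = p.pivMat F ℓ :=
  rfl

/-- A separable representation with at most `χ_ℓ` terms (any `r ≤ χ_ℓ`) gives one with exactly
`χ_ℓ` terms (pad `u`, `v` with zeros): "rank `≤ χ_ℓ`" implies bond-separability with `χ_ℓ`
terms.  [cite: DolgovSavostyanov2020, §3.2] -/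
theorem bondSeparable_of_sum_eq {ℓ r : ℕ} (hr : r ≤ p.χ ℓ) (u v : List σ → Fin r → K)
    (h : ∀ x y : List σ, x.length = ℓ → y.length = p.n + 1 - ℓ →
      F (x ++ y) = ∑ t, u x t * v y t) :
    p.BondSeparable F ℓ := by
  classical
  refine ⟨fun x t => if ht : (t : ℕ) < r then u x ⟨t, ht⟩ else 0,
    fun y t => if ht : (t : ℕ) < r then v y ⟨t, ht⟩ else 0, fun x y hx hy => ?_⟩
  rw [h x y hx hy]
  -- the sum over `Fin (χ ℓ)` is supported on the image of `Fin r`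
  have hsupp : ∑ t : Fin (p.χ ℓ), (if ht : (t : ℕ) < r then u x ⟨t, ht⟩ else 0) *
      (if ht : (t : ℕ) < r then v y ⟨t, ht⟩ else 0) =
      ∑ t ∈ (Finset.univ : Finset (Fin r)).map (Fin.castLEEmb hr),
        (if ht : (t : ℕ) < r then u x ⟨t, ht⟩ else 0) *
          (if ht : (t : ℕ) < r then v y ⟨t, ht⟩ else 0) := by
    symm
    refine Finset.sum_subset (Finset.subset_univ _) fun t _ ht => ?_
    have htr : ¬ (t : ℕ) < r := by
      intro htr
      exact ht (Finset.mem_map.mpr ⟨⟨t, htr⟩, Finset.mem_univ _, Fin.ext rfl⟩)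
    simp [htr]
  rw [hsupp, Finset.sum_map]
  refine Finset.sum_congr rfl fun t _ => ?_
  simp [Fin.castLEEmb]

/-! ### Exact recovery -/

/-- THE INDUCTION BEHIND EXACT RECOVERY.  If `F` is bond-separable with `χ_ℓ` terms at every inner
bond `1 ≤ ℓ ≤ n` and the pivot matrices `P_ℓ` are nonsingular, then for every `k ≤ n` the row
vector `T₀^{σ₀} P₁⁻¹ T₁^{σ₁} ⋯ P_k⁻¹ T_k^{σ_k}` (indexed by `J_{k+2}`) is
`y ↦ F(σ₀ … σ_k ⊕ col (k+1) y)` — with NO nesting assumption.  Step: by induction the left factor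
is `y ↦ A(i, c y)` for the unfolding `A = A^{(k+1)}`, `i = (σ₀ … σ_k)`, and
`A(i, J) P_{k+1}⁻¹ A(I, j) = A(i, j)` by `sum_mul_inv_mul_eq_of_sum_eq`.
[cite: DolgovSavostyanov2020, §3.2 Thm. 2][cite: NunezFernandezEtAl2022, §III.B.1] -/
theorem leftProd_mul_siteMat_eq_of_bondSeparable (s : ℕ → σ)
    (hsep : ∀ ℓ, 1 ≤ ℓ → ℓ ≤ p.n → p.BondSeparable F ℓ)
    (hP : ∀ ℓ, 1 ≤ ℓ → ℓ ≤ p.n → IsUnit (p.pivMat F ℓ).det) :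
    ∀ k, k ≤ p.n → p.leftProd F s k * p.siteMat F k (s k) =
      Matrix.of fun (_ : Fin (p.χ 0)) (y : Fin (p.χ (k + 1))) => F (pfx s (k + 1) ++ p.col (k + 1) y)
  | 0, _ => by
      ext x₀ y
      have h0 : p.row 0 x₀ = [] := List.eq_nil_of_length_eq_zero (p.length_row 0 x₀)
      simp [leftProd, h0, pfx]
  | k + 1, hk => by
      ext x₀ y'
      obtain ⟨u, v, huv⟩ := hsep (k + 1) (Nat.succ_pos k) hk
      have hPk : IsUnit (Matrix.of fun x y => F (p.row (k + 1) x ++ p.col (k + 1) y)).det :=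
        hP (k + 1) (Nat.succ_pos k) hk
      have key := sum_mul_inv_mul_eq_of_sum_eq (A := fun x y : List σ => F (x ++ y))
        (Pm := fun x : List σ => x.length = k + 1)
        (Pn := fun y : List σ => y.length = p.n + 1 - (k + 1))
        (fun i hi j hj => huv i j hi hj) (r := p.row (k + 1)) (c := p.col (k + 1))
        (p.length_row (k + 1)) (p.length_col (k + 1)) hPk (length_pfx' s (k + 1))
        (j := s (k + 1) :: p.col (k + 1 + 1) y')
        (by rw [List.length_cons, p.length_col]; omega)
      rw [leftProd_succ, ← Matrix.mul_assoc,
        leftProd_mul_siteMat_eq_of_bondSeparable s hsep hP k (Nat.le_of_succ_le hk),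
        Matrix.mul_apply, Matrix.of_apply, pfx_succ' s (k + 1), List.append_assoc,
        List.singleton_append]
      simp only [Matrix.mul_apply, Matrix.of_apply, siteMat_apply]
      exact key

/-- EXACT RECOVERY, matrix form: under bond-separability with `χ_ℓ` terms at every inner bond and
nonsingular pivot matrices, the `1 × 1` matrix `F̃(s) = T₀ P₁⁻¹ ⋯ P_n⁻¹ T_n` equals `F(s)`.
[cite: DolgovSavostyanov2020, §3.2 Thm. 2][cite: NunezFernandezEtAl2022, §III.B.1] -/
theorem tciForm_apply_of_bondSeparable (s : ℕ → σ)
    (hsep : ∀ ℓ, 1 ≤ ℓ → ℓ ≤ p.n → p.BondSeparable F ℓ)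
    (hP : ∀ ℓ, 1 ≤ ℓ → ℓ ≤ p.n → IsUnit (p.pivMat F ℓ).det)
    (x₀ : Fin (p.χ 0)) (y₀ : Fin (p.χ (p.n + 1))) :
    p.tciForm F s x₀ y₀ = F (pfx s (p.n + 1)) := by
  have hcol : p.col (p.n + 1) y₀ = [] :=
    List.eq_nil_of_length_eq_zero (by rw [p.length_col]; omega)
  rw [p.tciForm_eq_leftProd_mul_siteMat_mul_rightProd F s p.n le_rfl, rightProd_last,
    Matrix.mul_one, p.leftProd_mul_siteMat_eq_of_bondSeparable F s hsep hP p.n le_rfl,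
    Matrix.of_apply, hcol, List.append_nil]

/-- EXACT RECOVERY OF THE EXACT-RANK TENSOR (ring form).  If `F` is bond-separable with `χ_ℓ`
terms across every inner bond `1 ≤ ℓ ≤ n` (its unfoldings factor through `K^{χ_ℓ}`) and all the
pivot matrices `P_ℓ` are nonsingular, then the TCI form recovers `F` EXACTLY at every
configuration: `F̃(s) = F(s)`.  No nesting of the pivots is required.
[cite: DolgovSavostyanov2020, §3.2 Thm. 2][cite: NunezFernandezEtAl2022, §III.B.1] -/
theorem tciEval_of_bondSeparable (s : ℕ → σ)
    (hsep : ∀ ℓ, 1 ≤ ℓ → ℓ ≤ p.n → p.BondSeparable F ℓ)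
    (hP : ∀ ℓ, 1 ≤ ℓ → ℓ ≤ p.n → IsUnit (p.pivMat F ℓ).det) :
    p.tciEval F s = F (pfx s (p.n + 1)) := by
  rw [p.tciEval_eq_tciForm F s p.rowZero p.colLast]
  exact p.tciForm_apply_of_bondSeparable F s hsep hP _ _

/-- Exact recovery in configuration form: `F̃(l) = F(l)` for every configuration `l` (a list of
`n+1` leg indices).  [cite: DolgovSavostyanov2020, §3.2 Thm. 2][cite: NunezFernandezEtAl2022,
§III.B.1] -/
theorem tciEval_toSeq_of_bondSeparable
    (hsep : ∀ ℓ, 1 ≤ ℓ → ℓ ≤ p.n → p.BondSeparable F ℓ)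
    (hP : ∀ ℓ, 1 ≤ ℓ → ℓ ≤ p.n → IsUnit (p.pivMat F ℓ).det) (l : List σ)
    (hl : l.length = p.n + 1) (d : σ) :
    p.tciEval F (toSeq l d) = F l := by
  rw [p.tciEval_of_bondSeparable F _ hsep hP, ← hl, pfx_toSeq_length']

/-! ### The converse: the TCI form itself is bond-separable -/

/-- The TCI form, as a tensor on configurations, is bond-separable with `χ_ℓ` terms across every
bond `1 ≤ ℓ ≤ n+1`: it is a tensor train of bond dimensions `χ_ℓ` (`tciEval_eq_sum_bond`; the
left factor depends only on the legs `< ℓ`, the right factor only on the legs `≥ ℓ`).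
[cite: NunezFernandezEtAl2025, §4.1][cite: DolgovSavostyanov2020, §3.2] -/
theorem bondSeparable_tciEval (d : σ) {ℓ : ℕ} (hℓ₁ : 1 ≤ ℓ) (hℓ : ℓ ≤ p.n + 1) :
    p.BondSeparable (fun l => p.tciEval F (toSeq l d)) ℓ := by
  obtain ⟨k, rfl⟩ : ∃ k, ℓ = k + 1 := ⟨ℓ - 1, by omega⟩
  refine ⟨fun x t => (p.leftProd F (toSeq x d) k * p.siteMat F k (toSeq x d k)) p.rowZero t,
    fun y t => p.rightProd F (toSeq (List.replicate (k + 1) d ++ y) d) (k + 1) t p.colLast,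
    fun x y hx _ => ?_⟩
  dsimp only
  rw [p.tciEval_eq_sum_bond F _ (show k ≤ p.n by omega)]
  refine Finset.sum_congr rfl fun t _ => ?_
  have h₁ : ∀ j < k + 1, toSeq (x ++ y) d j = toSeq x d j := fun j hj =>
    toSeq_append_of_lt' x y d (by rw [hx]; exact hj)
  rw [p.leftProd_congr F k fun j hj => h₁ j (Nat.lt_succ_of_lt hj), h₁ k (Nat.lt_succ_self k),
    p.rightProd_congr F (p.n - k) (k + 1) (by omega) fun j hj =>
      toSeq_append_of_le' x (List.replicate (k + 1) d) y d (by simp [hx]) (by rw [hx]; exact hj)]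

/-- CHARACTERISATION OF EXACT RECOVERY.  For pivot lists with nonsingular pivot matrices, the TCI
form recovers the tensor at every configuration IF AND ONLY IF the tensor is bond-separable with
`χ_ℓ` terms across every inner bond: "if" is the exact-recovery theorem, "only if" holds because
the TCI form is a tensor train of bond dimensions `χ_ℓ`.
[cite: DolgovSavostyanov2020, §3.2 Thm. 2][cite: NunezFernandezEtAl2025, §4.1] -/
theorem tciEval_toSeq_eq_iff_bondSeparable
    (hP : ∀ ℓ, 1 ≤ ℓ → ℓ ≤ p.n → IsUnit (p.pivMat F ℓ).det) (d : σ) :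
    (∀ l : List σ, l.length = p.n + 1 → p.tciEval F (toSeq l d) = F l) ↔
      ∀ ℓ, 1 ≤ ℓ → ℓ ≤ p.n → p.BondSeparable F ℓ := by
  refine ⟨fun h ℓ hℓ₁ hℓ => ?_, fun hsep l hl => p.tciEval_toSeq_of_bondSeparable F hsep hP l hl d⟩
  obtain ⟨u, v, huv⟩ := p.bondSeparable_tciEval F d hℓ₁ (by omega)
  refine ⟨u, v, fun x y hx hy => ?_⟩
  rw [← h (x ++ y) (by rw [List.length_append, hx, hy]; omega)]
  exact huv x y hx hy

/-! ### Tensor trains are bond-separable: the TCI form recovers a tensor train exactly -/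

/-- A TENSOR TRAIN OF BOND DIMENSIONS `r_ℓ ≤ χ_ℓ` IS BOND-SEPARABLE with `χ_ℓ` terms: if `F`
agrees on the `(n+1)`-leg configurations (`Fin (n+1) → σ`, read as the lists `List.ofFn`) with
the values of a tensor train `T`, then across every bond `ℓ ≤ n+1` with `T.r ℓ ≤ χ_ℓ` it is a sum
of `χ_ℓ` products — left factor `lbdry · M_0^{x_0} ⋯ M_{ℓ-1}^{x_{ℓ-1}}`, right factor
`M_ℓ^{y_0} ⋯ M_n^{y_{n-ℓ}} · rbdry` (`TensorTrain.eval_append_eq_sum_bond`), padded with zeros.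
[cite: NunezFernandezEtAl2022, §III.B.1][cite: DolgovSavostyanov2020, §3.2] -/
theorem bondSeparable_of_tensorTrain (T : TensorTrain K σ (p.n + 1))
    (hF : ∀ s : Fin (p.n + 1) → σ, F (List.ofFn s) = T.eval s) {ℓ : ℕ} (hℓ : ℓ ≤ p.n + 1)
    (hr : T.r ℓ ≤ p.χ ℓ) : p.BondSeparable F ℓ := by
  classical
  have h : ℓ + (p.n + 1 - ℓ) = p.n + 1 := by omega
  refine p.bondSeparable_of_sum_eq F hr
    (fun x t => if hx : x.length = ℓ then
      (T.lbdry ᵥ* T.leftProd ℓ fun i => x.get (i.cast hx.symm)) t else 0)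
    (fun y t => if hy : y.length = p.n + 1 - ℓ then
      ((Matrix.of fun l j => T.segProd ℓ (p.n + 1 - ℓ) (fun i => y.get (i.cast hy.symm)) l
          (j.cast (congrArg T.r h).symm)) *ᵥ T.rbdry) t else 0)
    fun x y hx hy => ?_
  simp only [dif_pos hx, dif_pos hy]
  set sx : Fin ℓ → σ := fun i => x.get (i.cast hx.symm) with hsx
  set sy : Fin (p.n + 1 - ℓ) → σ := fun i => y.get (i.cast hy.symm) with hsy
  have hxy : x ++ y = List.ofFn fun i => Fin.append sx sy (i.cast h.symm) := by
    rw [← List.ofFn_congr h (Fin.append sx sy), List.ofFn_fin_append, hsx, hsy,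
      ← List.ofFn_congr hx x.get, ← List.ofFn_congr hy y.get, List.ofFn_get, List.ofFn_get]
  rw [hxy, hF, T.eval_append_eq_sum_bond ℓ (p.n + 1 - ℓ) h sx sy]

/-- THE TCI FORM RECOVERS A TENSOR TRAIN EXACTLY: if `F` is, on configurations, a tensor train
with bond dimensions `r_ℓ ≤ χ_ℓ` at the inner bonds `1 ≤ ℓ ≤ n`, and the pivot matrices `P_ℓ` are
nonsingular, then the TCI form built from the `χ_ℓ` pivots per bond equals `F` at EVERY
configuration (NF22: if a tensor has rank `χ`, "the tensor train is an exact representation of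
the tensor").  No nesting of the pivots is required.
[cite: NunezFernandezEtAl2022, §III.B.1][cite: DolgovSavostyanov2020, §3.2 Thm. 2] -/
theorem tciEval_ofFn_of_tensorTrain (T : TensorTrain K σ (p.n + 1))
    (hF : ∀ s : Fin (p.n + 1) → σ, F (List.ofFn s) = T.eval s)
    (hr : ∀ ℓ, 1 ≤ ℓ → ℓ ≤ p.n → T.r ℓ ≤ p.χ ℓ)
    (hP : ∀ ℓ, 1 ≤ ℓ → ℓ ≤ p.n → IsUnit (p.pivMat F ℓ).det) (s : Fin (p.n + 1) → σ) (d : σ) :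
    p.tciEval F (toSeq (List.ofFn s) d) = T.eval s := by
  rw [p.tciEval_toSeq_of_bondSeparable F
    (fun ℓ h₁ h₂ => p.bondSeparable_of_tensorTrain F T hF (by omega) (hr ℓ h₁ h₂)) hP
    (List.ofFn s) (by simp) d, hF]

end CommRing

/-! ### Over a field: unfolding ranks -/

section Field

variable {σ : Type*} (p : TCIPivots σ) {K : Type*} [Field K] (F : List σ → K)

/-- A bond-separable tensor has unfolding rank `≤ χ_ℓ` (the unfolding factors through `K^{χ_ℓ}`).
[cite: DolgovSavostyanov2020, §3.1–§3.2] -/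
theorem rank_unfolding_le_of_bondSeparable [Fintype σ] {ℓ : ℕ} (h : p.BondSeparable F ℓ) :
    (p.unfolding F ℓ).rank ≤ p.χ ℓ := by
  classical
  obtain ⟨u, v, huv⟩ := h
  have hUV : p.unfolding F ℓ = (Matrix.of fun (x : List.Vector σ ℓ) (t : Fin (p.χ ℓ)) => u x.1 t) *
      Matrix.of fun (t : Fin (p.χ ℓ)) (y : List.Vector σ (p.n + 1 - ℓ)) => v y.1 t := by
    ext x y
    rw [unfolding_apply, Matrix.mul_apply, huv x.1 y.1 x.2 y.2]
    rfl
  rw [hUV]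
  calc _ ≤ (Matrix.of fun (x : List.Vector σ ℓ) (t : Fin (p.χ ℓ)) => u x.1 t).rank :=
      Matrix.rank_mul_le_left _ _
    _ ≤ Fintype.card (Fin (p.χ ℓ)) := Matrix.rank_le_card_width _
    _ = p.χ ℓ := Fintype.card_fin _

/-- With a nonsingular `χ_ℓ × χ_ℓ` pivot matrix, a bond-separable tensor has unfolding rank
EXACTLY `χ_ℓ` (the pivot matrix is a nonsingular submatrix of the unfolding).
[cite: DolgovSavostyanov2020, §3.2 Thm. 2] -/
theorem rank_unfolding_eq_of_bondSeparable [Fintype σ] {ℓ : ℕ} (h : p.BondSeparable F ℓ)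
    (hP : IsUnit (p.pivMat F ℓ).det) : (p.unfolding F ℓ).rank = p.χ ℓ := by
  refine le_antisymm (p.rank_unfolding_le_of_bondSeparable F h) ?_
  have hP' : IsUnit ((p.unfolding F ℓ).submatrix
      (fun x => (⟨p.row ℓ x, p.length_row ℓ x⟩ : List.Vector σ ℓ))
      (fun y => (⟨p.col ℓ y, p.length_col ℓ y⟩ : List.Vector σ (p.n + 1 - ℓ)))).det := by
    rw [submatrix_unfolding]; exact hP
  simpa using Literature.LinearAlgebra.Matrix.card_le_rank_of_isUnit_det_submatrix _ hP'

/-- RANK `≤ χ_ℓ` IMPLIES BOND-SEPARABILITY (given the nonsingular pivot matrix): over a field with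
finitely many leg values, if `rank A^{(ℓ)} ≤ χ_ℓ` and `P_ℓ = A^{(ℓ)}(I_ℓ, J_{ℓ+1})` is nonsingular
then `A^{(ℓ)} = A^{(ℓ)}(:, J) P_ℓ⁻¹ A^{(ℓ)}(I, :)` by the exactness of the matrix cross
interpolation at full rank (`Literature.LinearAlgebra.Matrix.crossInterp_eq_self_of_rank_eq`),
which is a separable representation with `χ_ℓ` terms.
[cite: DolgovSavostyanov2020, §2.1 (1) and §3.2][cite: NunezFernandezEtAl2025, §3.1 property (i)] -/
theorem bondSeparable_of_rank_le [Fintype σ] {ℓ : ℕ} (hP : IsUnit (p.pivMat F ℓ).det)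
    (hrank : (p.unfolding F ℓ).rank ≤ p.χ ℓ) : p.BondSeparable F ℓ := by
  classical
  let r : Fin (p.χ ℓ) → List.Vector σ ℓ := fun x => ⟨p.row ℓ x, p.length_row ℓ x⟩
  let c : Fin (p.χ ℓ) → List.Vector σ (p.n + 1 - ℓ) := fun y => ⟨p.col ℓ y, p.length_col ℓ y⟩
  have hP' : IsUnit ((p.unfolding F ℓ).submatrix r c).det := by
    rw [submatrix_unfolding]; exact hP
  have hrank' : (p.unfolding F ℓ).rank = Fintype.card (Fin (p.χ ℓ)) := by
    rw [Fintype.card_fin]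
    refine le_antisymm hrank ?_
    simpa using Literature.LinearAlgebra.Matrix.card_le_rank_of_isUnit_det_submatrix _ hP'
  have hA := Literature.LinearAlgebra.Matrix.crossInterp_eq_self_of_rank_eq _ hP' hrank'
  refine ⟨fun x t => if hx : x.length = ℓ then
      ((p.unfolding F ℓ).submatrix id c * ((p.unfolding F ℓ).submatrix r c)⁻¹) ⟨x, hx⟩ t else 0,
    fun y t => if hy : y.length = p.n + 1 - ℓ then
      (p.unfolding F ℓ).submatrix r id t ⟨y, hy⟩ else 0,
    fun x y hx hy => ?_⟩
  simp only [dif_pos hx, dif_pos hy]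
  have hxy := congr_fun (congr_fun hA ⟨x, hx⟩) ⟨y, hy⟩
  rw [Literature.LinearAlgebra.Matrix.crossInterp_def, Matrix.mul_apply] at hxy
  rw [hxy]
  rfl

/-- EXACT RECOVERY OF THE EXACT-RANK TENSOR [DolgovSavostyanov2020, Thm. 2], in the printed form:
over a field with finitely many leg values, if `rank A^{(ℓ)} = χ_ℓ` for every inner bond
`1 ≤ ℓ ≤ n` (every unfolding has rank equal to the number of pivots at that bond) and all the
pivot matrices `P_ℓ = A^{(ℓ)}(I_ℓ, J_{ℓ+1})` are nonsingular, then the cross formula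
`F̃ = T₀ P₁⁻¹ T₁ ⋯ P_n⁻¹ T_n` recovers the tensor exactly, `F̃(s) = F(s)` for every configuration —
nested or not.  [cite: DolgovSavostyanov2020, §3.2 Thm. 2][cite: NunezFernandezEtAl2022, §III.B.1] -/
theorem tciEval_of_rank_eq [Fintype σ]
    (hrank : ∀ ℓ, 1 ≤ ℓ → ℓ ≤ p.n → (p.unfolding F ℓ).rank = p.χ ℓ)
    (hP : ∀ ℓ, 1 ≤ ℓ → ℓ ≤ p.n → IsUnit (p.pivMat F ℓ).det) (s : ℕ → σ) :
    p.tciEval F s = F (pfx s (p.n + 1)) :=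
  p.tciEval_of_bondSeparable F s
    (fun ℓ h₁ h₂ => p.bondSeparable_of_rank_le F (hP ℓ h₁ h₂) (hrank ℓ h₁ h₂).le) hP

/-- `tciEval_of_rank_eq` in configuration form: `F̃(l) = F(l)` for every list `l` of `n+1` leg
indices.  [cite: DolgovSavostyanov2020, §3.2 Thm. 2] -/
theorem tciEval_toSeq_of_rank_eq [Fintype σ]
    (hrank : ∀ ℓ, 1 ≤ ℓ → ℓ ≤ p.n → (p.unfolding F ℓ).rank = p.χ ℓ)
    (hP : ∀ ℓ, 1 ≤ ℓ → ℓ ≤ p.n → IsUnit (p.pivMat F ℓ).det) (l : List σ)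
    (hl : l.length = p.n + 1) (d : σ) :
    p.tciEval F (toSeq l d) = F l :=
  p.tciEval_toSeq_of_bondSeparable F
    (fun ℓ h₁ h₂ => p.bondSeparable_of_rank_le F (hP ℓ h₁ h₂) (hrank ℓ h₁ h₂).le) hP l hl d

/-- CHARACTERISATION over a field: for pivot lists with nonsingular pivot matrices, the cross
formula recovers the tensor everywhere IF AND ONLY IF `rank A^{(ℓ)} = χ_ℓ` at every inner bond.
[cite: DolgovSavostyanov2020, §3.2 Thm. 2][cite: NunezFernandezEtAl2025, §4.1] -/
theorem tciEval_toSeq_eq_iff_rank_eq [Fintype σ]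
    (hP : ∀ ℓ, 1 ≤ ℓ → ℓ ≤ p.n → IsUnit (p.pivMat F ℓ).det) (d : σ) :
    (∀ l : List σ, l.length = p.n + 1 → p.tciEval F (toSeq l d) = F l) ↔
      ∀ ℓ, 1 ≤ ℓ → ℓ ≤ p.n → (p.unfolding F ℓ).rank = p.χ ℓ := by
  rw [p.tciEval_toSeq_eq_iff_bondSeparable F hP d]
  exact ⟨fun h ℓ h₁ h₂ => p.rank_unfolding_eq_of_bondSeparable F (h ℓ h₁ h₂) (hP ℓ h₁ h₂),
    fun h ℓ h₁ h₂ => p.bondSeparable_of_rank_le F (hP ℓ h₁ h₂) (h ℓ h₁ h₂).le⟩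

end Field

end TCIPivots

end Literature.LinearAlgebra.TensorNetworks
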